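import Summits.FinalStateConjecture.FinalStateConjecture.Theses.ZeroEnergyKerrOrBomb
import Literature.Geometry.Lorentzian.IPlusRegular
import Literature.Geometry.Lorentzian.GlobalHyperbolicityStrongCausalityProofs
import Literature.Geometry.Lorentzian.CausalityPushUp
import Literature.Geometry.Lorentzian.CausalityOpennessProofs
import Literature.Geometry.Lorentzian.StaticBlackHoleUniquenessProofs

/-!
# `ZeroEnergyRigidity`, line `global-horizon-killing-field` — stub `stub_docGloballyHyperbolicSet`

Crux `stmt-FinalStateConjecture-10690`
(`Summit.FinalStateConjecture.FinalStateConjecture.Theses.ZeroEnergyKerrOrBomb.ZeroEnergyRigidity`),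
stub S1a of the second lead's reshaped skeleton: **the domain of outer communications of a globally
hyperbolic presentation is a globally hyperbolic set.**

For a presentation `𝓑 : StationaryAFBlackHole` whose carrier `(M, g, τ)` is globally hyperbolic in
the Bernal–Sánchez form (`IsGloballyHyperbolic`: causal, all causal diamonds `J⁺(p) ∩ J⁻(q)`
compact — hypothesis h4 of the crux), the d.o.c. `⟨⟨M_ext⟩⟩ = I⁺(M_ext) ∩ I⁻(M_ext)` (`𝓑.doc`) is a
globally hyperbolic SET in the sense of Hawking–Ellis §6.6 (`IsGloballyHyperbolicSet`, the second
clause of Chruściel–Costa's `I⁺`-regularity, Def. 1.1):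

* strong causality at every point of `⟨⟨M_ext⟩⟩` — in fact at every point of `M`: Bernal–Sánchez
  2007, Thm. 3.2, globally hyperbolic ⇒ strongly causal on a connected Hausdorff second countable
  `4`-manifold without boundary
  (`LorentzianMetric.bernalSanchez_isStronglyCausal_of_isGloballyHyperbolic_holds`);
* every diamond `J⁺(p) ∩ J⁻(q)`, `p q ∈ ⟨⟨M_ext⟩⟩`, is compact (h4) and contained in `⟨⟨M_ext⟩⟩`:
  causal convexity of `I⁺(A) ∩ I⁻(A)` by push-up, `m ≪ p ≤ x ⟹ m ≪ x` and `x ≤ q ≪ m' ⟹ x ≪ m'`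
  (O'Neill 1983, Ch. 14, Cor. 14.1; tree lemma
  `StationaryAFBlackHole.causalFuture_inter_causalPast_subset_doc`).

References: A. N. Bernal, M. Sánchez, Class. Quantum Grav. 24 (2007) 745–749, Thm. 3.2;
S. W. Hawking, G. F. R. Ellis, *The large scale structure of space-time* (1973), §6.6 (p. 206);
B. O'Neill, *Semi-Riemannian geometry* (1983), Ch. 14, Cor. 14.1 (p. 402);
P. T. Chruściel, J. L. Costa, Astérisque 321 (2008), Def. 1.1.
-/

noncomputable section

-- `Summit.FinalStateConjecture.FinalStateConjecture.…`: summit = problem name (D-0017).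
set_option linter.dupNamespace false

namespace Summit.FinalStateConjecture.FinalStateConjecture.Theorems.ZeroEnergyRigidity.GlobalHorizonKillingField.DocGloballyHyperbolicSet

open Set Function Literature.Geometry.Lorentzian
open scoped Manifold ContDiff Topology

/-- A globally hyperbolic presentation (Bernal–Sánchez form) is strongly causal at every point of
its carrier: Bernal–Sánchez 2007, Thm. 3.2, on the connected Hausdorff second countable
`4`-manifold without boundary `𝓑.carrier` with its `C^∞` metric
(`LorentzianMetric.bernalSanchez_isStronglyCausal_of_isGloballyHyperbolic_holds`).
[cite: BernalSanchez2007CQG, Thm. 3.2 (p. 747)] -/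
theorem isStronglyCausalAt_of_isGloballyHyperbolic (𝓑 : StationaryAFBlackHole.{0})
    (hG : 𝓑.metric.IsGloballyHyperbolic 𝓑.timeOrientation) (p : 𝓑.carrier) :
    𝓑.metric.IsStronglyCausalAt 𝓑.timeOrientation p :=
  LorentzianMetric.isStronglyCausal_iff_forall_isStronglyCausalAt.mp
    (LorentzianMetric.bernalSanchez_isStronglyCausal_of_isGloballyHyperbolic_holds 𝓑.metric
      𝓑.timeOrientation (WithTop.coe_le_coe.mpr le_top) hG) p

/-- **Stub S1a · docGloballyHyperbolicSet** (line `global-horizon-killing-field`, crux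
`stmt-FinalStateConjecture-10690`): if the carrier of `𝓑` is globally hyperbolic (causal with
compact causal diamonds) then `⟨⟨M_ext⟩⟩ = I⁺(M_ext) ∩ I⁻(M_ext)` is a globally hyperbolic set
(Hawking–Ellis 1973, §6.6): strong causality at its points (Bernal–Sánchez 2007, Thm. 3.2),
compact diamonds (the hypothesis) contained in it (causal convexity of the d.o.c. by push-up,
O'Neill 1983, Ch. 14, Cor. 14.1: `StationaryAFBlackHole.causalFuture_inter_causalPast_subset_doc`).
This is the second clause of Chruściel–Costa 2008, Def. 1.1. [cite: HawkingEllis1973, §6.6 (p. 206)] -/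
theorem stub_docGloballyHyperbolicSet :
    ∀ (𝓑 : StationaryAFBlackHole.{0}),
      𝓑.metric.IsGloballyHyperbolic 𝓑.timeOrientation →
        𝓑.toSpacetime.IsGloballyHyperbolicSet 𝓑.doc := fun 𝓑 hG ↦
  ⟨fun p _ ↦ isStronglyCausalAt_of_isGloballyHyperbolic 𝓑 hG p,
    fun _ hp _ hq ↦ ⟨hG.isCompact_causalFuture_inter_causalPast _ _,
      𝓑.causalFuture_inter_causalPast_subset_doc hp hq⟩⟩

end Summit.FinalStateConjecture.FinalStateConjecture.Theorems.ZeroEnergyRigidity.GlobalHorizonKillingField.DocGloballyHyperbolicSet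

end
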